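import Summits.CriticalPhenomena.Ising3DConformalLimit.Theses.InverseSquareTelemetry
import Literature.Probability.LatticeModels.IsingThermodynamics
import Literature.Probability.LatticeModels.IsingDecoration
import Literature.Probability.LatticeModels.LatticeLaplacianZd

/-!
# Callen's identity for the critical plus state on `ℤ³`

Route `InverseSquareTelemetry` of `CriticalPhenomena / Ising3DConformalLimit`, support item
`stmt-CriticalPhenomena-4500` (`CallenIdentity`): for `x ≠ 0`,

`⟨σ₀ σ_x⟩⁺_{β_c} = ⟨σ₀ · tanh(β_c ∑ᵢ (σ_{x+eᵢ} + σ_{x−eᵢ}))⟩⁺_{β_c}`,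

with both sides the `limUnder` along boxes defining the plus state `plusExpect`
(Callen 1963; the one-site DLR / heat-bath identity, Friedli–Velenik 2017, Lemma 6.7; Cho et al.
2022 use the same identities as bootstrap constraints).

## Proof

* Finite volume: the tree's heat-bath identity `isingExpect_spinAt_mul_eq_tanh`
  (`Literature/Probability/LatticeModels/IsingDecoration.lean`; any locally finite graph, any
  fixed boundary condition, zero field): for `x ∈ Λ` and a measurable `g` not reading `σ_x`,
  `⟨σ_x g⟩^η_{Λ;β,0} = ⟨tanh(β ∑_{y∼x} σ_y) · g⟩^η_{Λ;β,0}`. With `g = σ₀` (which does not read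
  `σ_x` since `x ≠ 0`), `η ≡ +1` (`.plus = .fixed 1`) and the neighbour sum on `ℤ^d` written over
  the `d` directions (`sum_neighborFinset_zdGraph`), the two finite-volume plus expectations in
  the box `B(L)` agree as soon as `x ∈ B(L)`; the boundary spins `+1` enter the neighbour sum
  through the glued configuration, exactly as in the Hamiltonian, so the neighbours of `x` need
  not lie in the box (`isingExpect_box_spinPair_eq_mul_tanh`).
* Hence the two box sequences inside `plusExpect` are eventually equal and have the same
  `limUnder`, whether or not they converge (`plusExpect_spinPair_eq_mul_tanh`,
  `Filter.map_congr`); `criticalTwoPoint 3 x` is `plusExpect 3 (criticalBeta 3) 0 (spinPair 0 x)`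
  by definition (`CallenIdentity_proof`).

## References

* H. B. Callen, *A note on Green functions and the Ising model*, Phys. Lett. 4 (1963) 161
  [Callen1963].
* S. Friedli, Y. Velenik, *Statistical Mechanics of Lattice Systems* (CUP 2017), §3.1, §3.4,
  Lemma 6.7 [FriedliVelenik2017].
* M. Cho et al., *Bootstrapping the Ising model on the lattice*, arXiv:2206.12538 (2022)
  [ChoEtAl2022].
-/

noncomputable section

namespace Summit.CriticalPhenomena.Ising3DConformalLimit.Theorems

open MeasureTheory Finset Filter
open Literature.Probability.LatticeModels

/-- **Callen's identity for the `+` state in a box of `ℤ^d`** containing `x ≠ 0` (zero field,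
any real `β`): `⟨σ₀ σ_x⟩⁺_{B(L);β,0} = ⟨σ₀ tanh(β ∑ᵢ (σ_{x+eᵢ} + σ_{x−eᵢ}))⟩⁺_{B(L);β,0}`
(neighbours of `x` outside the box carry the boundary spin `+1` on both sides, through the glued
configuration). The heat-bath identity `isingExpect_spinAt_mul_eq_tanh` with `g = σ₀`.
(Callen 1963; Friedli–Velenik 2017, Lemma 6.7.) [cite: Callen1963] -/
theorem isingExpect_box_spinPair_eq_mul_tanh {d : ℕ} (β : ℝ) {x : Site d} (h0 : x ≠ 0) {L : ℕ}
    (hL : x ∈ box d L) :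
    isingExpect (zdGraph d) (box d L) β 0 .plus (spinPair 0 x) =
      isingExpect (zdGraph d) (box d L) β 0 .plus (fun s => spinAt 0 s *
        Real.tanh (β * ∑ i : Fin d, (spinAt (x + Pi.single i 1) s + spinAt (x - Pi.single i 1) s))) := by
  -- `σ₀` does not read the spin at `x ≠ 0`
  have hg : ∀ (σ : SpinConfig (Site d)) (u : ℤˣ), spinAt 0 (Function.update σ x u) = spinAt 0 σ :=
    fun σ u => by simp only [spinAt, Function.update_of_ne h0.symm]
  have e1 : (spinPair 0 x : SpinConfig (Site d) → ℝ) = fun σ => spinAt x σ * spinAt 0 σ :=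
    funext fun σ => mul_comm _ _
  have e2 : (fun s : SpinConfig (Site d) => spinAt 0 s *
      Real.tanh (β * ∑ i : Fin d, (spinAt (x + Pi.single i 1) s + spinAt (x - Pi.single i 1) s))) =
      fun σ => Real.tanh (β * ∑ y ∈ (zdGraph d).neighborFinset x, spinAt y σ) * spinAt 0 σ :=
    funext fun σ => by rw [mul_comm, sum_neighborFinset_zdGraph]
  rw [e1, e2]
  exact isingExpect_spinAt_mul_eq_tanh (zdGraph d) hL β 1 (measurable_spinAt 0) hg

/-- **Callen's identity for the plus state `⟨·⟩⁺_{β,0}` on `ℤ^d`** (as the `limUnder` functional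
`plusExpect`), for every real `β` and every `x ≠ 0`:
`⟨σ₀ σ_x⟩⁺_{β,0} = ⟨σ₀ tanh(β ∑ᵢ (σ_{x+eᵢ} + σ_{x−eᵢ}))⟩⁺_{β,0}`. The two box sequences agree as
soon as the box contains `x`, hence have the same `limUnder` whether or not they converge.
(Callen 1963.) [cite: Callen1963] -/
theorem plusExpect_spinPair_eq_mul_tanh {d : ℕ} (β : ℝ) {x : Site d} (h0 : x ≠ 0) :
    plusExpect d β 0 (spinPair 0 x) =
      plusExpect d β 0 (fun s => spinAt 0 s *
        Real.tanh (β * ∑ i : Fin d, (spinAt (x + Pi.single i 1) s + spinAt (x - Pi.single i 1) s))) := by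
  have hxU : x ∈ ⋃ L : ℕ, ((box d L : Finset (Site d)) : Set (Site d)) := by
    rw [iUnion_coe_box]; trivial
  obtain ⟨L₀, hL₀⟩ := Set.mem_iUnion.1 hxU
  have hev : (fun L : ℕ => isingExpect (zdGraph d) (box d L) β 0 .plus (spinPair 0 x)) =ᶠ[atTop]
      fun L : ℕ => isingExpect (zdGraph d) (box d L) β 0 .plus (fun s => spinAt 0 s *
        Real.tanh (β * ∑ i : Fin d, (spinAt (x + Pi.single i 1) s + spinAt (x - Pi.single i 1) s))) := by
    filter_upwards [eventually_ge_atTop L₀] with L hL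
    exact isingExpect_box_spinPair_eq_mul_tanh β h0 (box_mono d hL (Finset.mem_coe.1 hL₀))
  unfold plusExpect Filter.limUnder
  rw [Filter.map_congr hev]

/-- **Item `stmt-CriticalPhenomena-4500` (`CallenIdentity`)**: Callen's identity for the critical
plus state on `ℤ³`, `⟨σ₀σ_x⟩⁺_{β_c} = ⟨σ₀ · tanh(β_c Σ_{y∼x} σ_y)⟩⁺_{β_c}` for `x ≠ 0`
(`criticalTwoPoint 3 x` is `plusExpect 3 (criticalBeta 3) 0 (spinPair 0 x)` by definition).
(Callen 1963.) [cite: Callen1963] -/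
theorem CallenIdentity_proof :
    Summit.CriticalPhenomena.Ising3DConformalLimit.Theses.InverseSquareTelemetry.CallenIdentity := by
  unfold Summit.CriticalPhenomena.Ising3DConformalLimit.Theses.InverseSquareTelemetry.CallenIdentity
  intro x hx
  exact plusExpect_spinPair_eq_mul_tanh (criticalBeta 3) hx

end Summit.CriticalPhenomena.Ising3DConformalLimit.Theorems

end
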